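import Summits.CriticalPhenomena.PercolationContinuityZ3.Theorems.PercNearOneGluingNoHeavyPcintBSMXTails
import HarnessLib

/-!
# PCINT lane, PHASE 6 (block renewal with reach-two pieces): the sharper dispersion bound and the two-axes tail

Cell `prim-pcint`, seat `prim-pcint-1` (gen 15); memo `run/shared/lean/prim/pcint/T-FIBRE-ROUTE.md` §PHASE 6.

The dispersion bound of …PcintBSMXLaw (`H n δ ² ≤ 1/((n+1) 4a₁)`) rests on `C(2i,i)² ≤ 16ⁱ/(i+1)`; the tree's sharper
`C(2i,i)² (3i+1) ≤ 16ⁱ` (`BSM.centralBinom_sq_mul_le`) gives `1/(3i+1) ≤ 1/(2(i+1))` for `i ≥ 1` and hence, at the price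
of an exponentially small term, HALF the constant: **`BSMX.F_zero_sq_le'`** (`F s N 0 ² ≤ 1/(2(N+1)s) + (1-s)^N/2`),
**`BSMX.H_sq_le'`** (`H a₁ a₂ n δ ² ≤ 1/(8a₁(n+1)) + (1-4a₁)ⁿ/2`).  For two time axes, where the tail of the Green series
decays only like `N^{-1/2}`, this halves the tail: **`BSMX.tailBound_two'`** (`T ≥ u 2 N · [(2N+2)/((2N+1) 8a₁) +
r^{2N}/(2(1-r²))]`, `r = 1 - 4a₁`) and its discharge from `ℚ` data **`BSMX.tailBoundH_of_twoQ'`**.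
-/

noncomputable section

namespace Summit.CriticalPhenomena.PercolationContinuityZ3.Theorems.Pcint.BSMX

open Finset OSM BSM

variable {t k : ℕ}

/-! ### The sharper lazy dispersion bound -/

/-- `cc i 0 ² ≤ 1/(3i+1)` (the tree's central binomial bound, as a real inequality). -/
theorem cc_zero_sq_le' (i : ℕ) : cc i 0 ^ 2 ≤ 1 / (3 * (i : ℝ) + 1) := by
  have h := centralBinom_sq_mul_le i
  have h' : ((Nat.centralBinom i : ℝ)) ^ 2 * (3 * (i : ℝ) + 1) ≤ (16 : ℝ) ^ i := by exact_mod_cast h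
  unfold cc
  rw [chooseZ_two_mul_self, ← Nat.centralBinom, div_pow, div_le_div_iff₀ (by positivity) (by positivity), one_mul]
  have : ((4 : ℝ) ^ i) ^ 2 = (16 : ℝ) ^ i := by rw [← pow_mul, mul_comm, pow_mul]; norm_num
  rw [this]
  exact h'

/-- **The sharper decay of the lazy return probability**: `F s N 0 ² ≤ 1/(2(N+1)s) + (1-s)^N/2`. -/
theorem F_zero_sq_le' {s : ℝ} (hs0 : 0 < s) (hs1 : s ≤ 1) (N : ℕ) :
    F s N 0 ^ 2 ≤ 1 / (2 * ((N : ℝ) + 1) * s) + (1 - s) ^ N / 2 := by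
  have ht : 0 ≤ 1 - s := by linarith
  set p : ℕ × ℕ → ℝ := fun ij => (N.choose ij.1 : ℝ) * s ^ ij.1 * (1 - s) ^ ij.2 with hp
  have hp0 : ∀ ij ∈ antidiagonal N, 0 ≤ p ij := fun ij _ =>
    mul_nonneg (mul_nonneg (by positivity) (pow_nonneg hs0.le _)) (pow_nonneg ht _)
  -- Cauchy–Schwarz: `(Σ p c)² ≤ (Σ p) (Σ p c²)`
  have hcs := sum_sq_le_sum_mul_sum_of_sq_le_mul (antidiagonal N) (r := fun ij => p ij * cc ij.1 0)
    (f := p) (g := fun ij => p ij * cc ij.1 0 ^ 2) hp0 (fun ij hij => mul_nonneg (hp0 ij hij) (sq_nonneg _))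
    (fun ij _ => by ring_nf; rfl)
  have hF : F s N 0 = ∑ ij ∈ antidiagonal N, p ij * cc ij.1 0 := rfl
  rw [hF]
  refine hcs.trans ?_
  rw [show ∑ ij ∈ antidiagonal N, p ij = 1 from sum_binomial_weights s N, one_mul]
  -- termwise: `p cc² ≤ p/(3i+1) ≤ (1/2) p/(i+1) + (1/2) p 𝟙[i=0]`
  have hterm : ∀ ij ∈ antidiagonal N, p ij * cc ij.1 0 ^ 2 ≤
      (1 / 2) * (p ij / ((ij.1 : ℝ) + 1)) + (1 / 2) * (if ij.1 = 0 then p ij else 0) := by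
    intro ij hij
    have h1 : p ij * cc ij.1 0 ^ 2 ≤ p ij * (1 / (3 * (ij.1 : ℝ) + 1)) :=
      mul_le_mul_of_nonneg_left (cc_zero_sq_le' ij.1) (hp0 ij hij)
    refine h1.trans ?_
    by_cases h0 : ij.1 = 0
    · have e1 : (1 : ℝ) / (3 * (ij.1 : ℝ) + 1) = 1 := by rw [h0]; norm_num
      have e2 : p ij / ((ij.1 : ℝ) + 1) = p ij := by rw [h0]; norm_num
      rw [if_pos h0, e1, e2, mul_one]
      linarith
    · rw [if_neg h0]
      have hi : (1 : ℝ) ≤ ij.1 := by exact_mod_cast Nat.one_le_iff_ne_zero.2 h0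
      have hle : 1 / (3 * (ij.1 : ℝ) + 1) ≤ (1 / 2) * (1 / ((ij.1 : ℝ) + 1)) := by
        rw [one_div_mul_one_div]
        exact one_div_le_one_div_of_le (by positivity) (by linarith)
      calc p ij * (1 / (3 * (ij.1 : ℝ) + 1)) ≤ p ij * ((1 / 2) * (1 / ((ij.1 : ℝ) + 1))) :=
            mul_le_mul_of_nonneg_left hle (hp0 ij hij)
        _ = (1 / 2) * (p ij / ((ij.1 : ℝ) + 1)) + (1 / 2) * 0 := by ring
  refine (sum_le_sum hterm).trans ?_
  have hind : ∑ ij ∈ antidiagonal N, (if ij.1 = 0 then p ij else 0) = (1 - s) ^ N := by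
    rw [Finset.sum_eq_single_of_mem (0, N) (by simp) ?_]
    · simp [hp]
    · intro b hb hne
      rw [if_neg]
      intro hb0
      apply hne
      rw [Finset.HasAntidiagonal.mem_antidiagonal] at hb
      exact Prod.ext hb0 (by simp only []; omega)
  rw [sum_add_distrib, ← mul_sum, ← mul_sum, hind]
  have h1 := sum_binomial_weights_div_le hs0 hs1 N
  have e : 1 / (2 * ((N : ℝ) + 1) * s) = (1 / 2) * (1 / (((N : ℝ) + 1) * s)) := by
    rw [one_div_mul_one_div]; ring_nf
  rw [e]
  linarith

/-! ### The sharper five-point dispersion bound -/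

/-- **`Bav n 0 ² ≤ 1/(8a₁(n+1)) + (1-4a₁)ⁿ/2`.** -/
theorem Bav_sq_le' {a₁ a₂ : ℝ} (h : Adm a₁ a₂) (n : ℕ) :
    Bav a₁ a₂ n 0 ^ 2 ≤ 1 / (8 * a₁ * ((n : ℝ) + 1)) + (1 - 4 * a₁) ^ n / 2 := by
  have hα0 := h.α_pos
  have hα1 := h.α_le_one
  have ht : 0 ≤ 1 - αm a₂ := by linarith
  have hs0 := h.sL_pos
  have hs1 := h.sL_le_one
  set p : ℕ × ℕ → ℝ := fun il => (n.choose il.1 : ℝ) * αm a₂ ^ il.1 * (1 - αm a₂) ^ il.2 with hp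
  have hp0 : ∀ il ∈ antidiagonal n, 0 ≤ p il := fun il _ =>
    mul_nonneg (mul_nonneg (by positivity) (pow_nonneg hα0.le _)) (pow_nonneg ht _)
  have hcs := sum_sq_le_sum_mul_sum_of_sq_le_mul (antidiagonal n) (r := fun il => p il * F (sL a₁ a₂) il.1 0)
    (f := p) (g := fun il => p il * F (sL a₁ a₂) il.1 0 ^ 2) hp0 (fun il hil => mul_nonneg (hp0 il hil) (sq_nonneg _))
    (fun il _ => by ring_nf; rfl)
  have hB : Bav a₁ a₂ n 0 = ∑ il ∈ antidiagonal n, p il * F (sL a₁ a₂) il.1 0 := by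
    unfold Bav; exact sum_congr rfl fun il _ => by rw [zero_add]
  rw [hB]
  refine hcs.trans ?_
  rw [show ∑ il ∈ antidiagonal n, p il = 1 from sum_binomial_weights (αm a₂) n, one_mul]
  -- termwise with the sharper lazy bound
  have hterm : ∀ il ∈ antidiagonal n, p il * F (sL a₁ a₂) il.1 0 ^ 2 ≤
      (1 / (2 * sL a₁ a₂)) * (p il / ((il.1 : ℝ) + 1)) +
        (1 / 2) * ((n.choose il.1 : ℝ) * (αm a₂ * (1 - sL a₁ a₂)) ^ il.1 * (1 - αm a₂) ^ il.2) := by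
    intro il hil
    have hF := F_zero_sq_le' hs0 hs1 il.1
    have h1 : p il * F (sL a₁ a₂) il.1 0 ^ 2 ≤ p il * (1 / (2 * ((il.1 : ℝ) + 1) * sL a₁ a₂) + (1 - sL a₁ a₂) ^ il.1 / 2) :=
      mul_le_mul_of_nonneg_left hF (hp0 il hil)
    refine h1.trans (le_of_eq ?_)
    rw [hp, mul_pow]
    field_simp
  refine (sum_le_sum hterm).trans ?_
  rw [sum_add_distrib, ← mul_sum, ← mul_sum]
  have h1 := sum_binomial_weights_div_le hα0 hα1 n
  -- the geometric part: `Σ C(n,i) (α(1-s'))ⁱ (1-α)^l = (α(1-s') + (1-α))ⁿ = (1 - α s')ⁿ = (1 - 4a₁)ⁿ`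
  have hgeo : ∑ il ∈ antidiagonal n, (n.choose il.1 : ℝ) * (αm a₂ * (1 - sL a₁ a₂)) ^ il.1 * (1 - αm a₂) ^ il.2 =
      (1 - 4 * a₁) ^ n := by
    have hb := (add_pow (αm a₂ * (1 - sL a₁ a₂)) (1 - αm a₂) n).symm
    rw [Finset.Nat.sum_antidiagonal_eq_sum_range_succ_mk] at *
    have e : αm a₂ * (1 - sL a₁ a₂) + (1 - αm a₂) = 1 - 4 * a₁ := by
      have := h.α_mul_sL; linear_combination (-1 : ℝ) * this
    rw [← e, ← hb]
    exact sum_congr rfl fun i _ => by ring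
  rw [hgeo]
  have hs' : 0 < sL a₁ a₂ := hs0
  have e2 : 1 / (8 * a₁ * ((n : ℝ) + 1)) = (1 / (2 * sL a₁ a₂)) * (1 / (((n : ℝ) + 1) * αm a₂)) := by
    rw [one_div_mul_one_div]
    congr 1
    have := h.α_mul_sL
    calc 8 * a₁ * ((n : ℝ) + 1) = 2 * (αm a₂ * sL a₁ a₂) * ((n : ℝ) + 1) := by rw [this]; ring
      _ = 2 * sL a₁ a₂ * (((n : ℝ) + 1) * αm a₂) := by ring
  rw [e2]
  have : (1 / (2 * sL a₁ a₂)) * ∑ il ∈ antidiagonal n, p il / ((il.1 : ℝ) + 1) ≤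
      (1 / (2 * sL a₁ a₂)) * (1 / (((n : ℝ) + 1) * αm a₂)) :=
    mul_le_mul_of_nonneg_left h1 (by positivity)
  linarith

/-- **The sharper dispersion bound**: `H a₁ a₂ n δ ² ≤ 1/(8a₁(n+1)) + (1-4a₁)ⁿ/2`. -/
theorem H_sq_le' {a₁ a₂ : ℝ} (h : Adm a₁ a₂) (n : ℕ) (δ : ℤ) :
    H a₁ a₂ n δ ^ 2 ≤ 1 / (8 * a₁ * ((n : ℝ) + 1)) + (1 - 4 * a₁) ^ n / 2 := by
  have h0 := H_nonneg h.a₁_nonneg h.nonneg h.two_le n δ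
  have h1 : H a₁ a₂ n δ ≤ Bav a₁ a₂ n 0 := by rw [← HL_zero]; exact HL_le h n 0 δ
  calc H a₁ a₂ n δ ^ 2 ≤ Bav a₁ a₂ n 0 ^ 2 := pow_le_pow_left₀ h0 h1 2
    _ ≤ _ := Bav_sq_le' h n

/-- The transverse factor bound, sharper form: `Π_l H (2i) (δ l) ≤ 1/(8a₁(2i+1)) + r^{2i}/2`, `r = 1 - 4a₁` (`t ≥ 2`). -/
theorem prod_H_le' {a₁ a₂ : ℝ} (h : Adm a₁ a₂) (ht : 2 ≤ t) (i : ℕ) (δ : Fin t → ℤ) :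
    ∏ l, H a₁ a₂ (2 * i) (δ l) ≤ 1 / (8 * a₁ * (2 * (i : ℝ) + 1)) + (1 - 4 * a₁) ^ (2 * i) / 2 := by
  refine (prod_H_le_two h ht (2 * i) δ).trans ?_
  have e0 := H_sq_le' h (2 * i) (δ ⟨0, by omega⟩)
  have e1 := H_sq_le' h (2 * i) (δ ⟨1, by omega⟩)
  push_cast at e0 e1
  nlinarith [sq_nonneg (H a₁ a₂ (2 * i) (δ ⟨0, by omega⟩) - H a₁ a₂ (2 * i) (δ ⟨1, by omega⟩))]

/-! ### The sharper two-axes tail -/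

/-- **From a window bound on `u k i · b i` (any termwise bound `b`) to a tail bound.** -/
theorem tailBoundH_of_window' {a₁ a₂ : ℝ} (h : Adm a₁ a₂) (hk : 2 ≤ k) {b : ℕ → ℝ}
    (hb : ∀ (i : ℕ) (δ : Fin t → ℤ), ∏ l, H a₁ a₂ (2 * i) (δ l) ≤ b i) {N : ℕ} {T : ℝ} (hT : 0 ≤ T)
    (hwin : ∀ m, ∑ i ∈ Ico N m, u k i * b i ≤ T) : TailBoundH t k a₁ a₂ N T := by
  have hterm : ∀ (i : ℕ) (δ : Fin t → ℤ), u k i * ∏ l, H a₁ a₂ (2 * i) (δ l) ≤ u k i * b i :=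
    fun i δ => mul_le_mul_of_nonneg_left (hb i δ) (u_nonneg i)
  refine ⟨hT, fun m δ => ⟨?_, ?_⟩⟩
  · exact sum_le_range_add hT (fun i => mul_nonneg (u_nonneg i) (prod_H_nonneg h _ δ))
      (fun m => (sum_le_sum fun i _ => hterm i δ).trans (hwin m)) m
  · exact sum_le_range_add hT (fun i => mul_nonneg (cadj_bounds hk i).1 (prod_H_nonneg h _ δ))
      (fun m => (sum_le_sum fun i _ => (mul_le_mul_of_nonneg_right (cadj_bounds hk i).2 (prod_H_nonneg h _ δ)).trans
        (hterm i δ)).trans (hwin m)) m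

/-- The geometric window: `Σ_{i ∈ [N,m)} u 2 i r^{2i} ≤ u 2 N r^{2N} / (1 - r²)` for `0 ≤ r < 1`. -/
theorem window_geo {r : ℝ} (hr0 : 0 ≤ r) (hr1 : r < 1) (N m : ℕ) :
    ∑ i ∈ Ico N m, u 2 i * r ^ (2 * i) ≤ u 2 N * r ^ (2 * N) / (1 - r ^ 2) := by
  have hr2 : r ^ 2 < 1 := by nlinarith
  have h1r : 0 < 1 - r ^ 2 := by linarith
  have huN := u_nonneg (d := 2) N
  calc ∑ i ∈ Ico N m, u 2 i * r ^ (2 * i) ≤ ∑ i ∈ Ico N m, u 2 N * r ^ (2 * i) :=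
        sum_le_sum fun i hi => mul_le_mul_of_nonneg_right (u_antitone (by norm_num) (mem_Ico.1 hi).1) (by positivity)
    _ = u 2 N * ∑ i ∈ Ico N m, (r ^ 2) ^ i := by
        rw [mul_sum]; exact sum_congr rfl fun i _ => by rw [pow_mul]
    _ ≤ u 2 N * ((r ^ 2) ^ N / (1 - r ^ 2)) :=
        mul_le_mul_of_nonneg_left (geom_sum_Ico_le_of_lt_one (sq_nonneg r) hr2) huN
    _ = u 2 N * r ^ (2 * N) / (1 - r ^ 2) := by rw [← pow_mul, mul_div_assoc]

/-- **The sharper tail bound for two time axes**: any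
`T ≥ u 2 N · [(2N+2) / ((2N+1) 8a₁) + r^{2N} / (2(1-r²))]`, `r = 1 - 4a₁`, is a tail bound (`t ≥ 2`, `4a₁ < 1`). -/
theorem tailBound_two' {a₁ a₂ : ℝ} (h : Adm a₁ a₂) (ht : 2 ≤ t) (ha : 4 * a₁ < 1) (N : ℕ) {T : ℝ}
    (hT : u 2 N * (2 * (N : ℝ) + 2) / ((2 * (N : ℝ) + 1) * (8 * a₁)) +
      u 2 N * (1 - 4 * a₁) ^ (2 * N) / (1 - (1 - 4 * a₁) ^ 2) / 2 ≤ T) : TailBoundH t 2 a₁ a₂ N T := by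
  have ha1 := h.pos
  set r : ℝ := 1 - 4 * a₁ with hr
  have hr0 : 0 ≤ r := by rw [hr]; linarith
  have hr1 : r < 1 := by rw [hr]; linarith
  have hr2 : 0 < 1 - r ^ 2 := by nlinarith
  have huN := u_nonneg (d := 2) N
  have hT0 : 0 ≤ u 2 N * (2 * (N : ℝ) + 2) / ((2 * (N : ℝ) + 1) * (8 * a₁)) +
      u 2 N * r ^ (2 * N) / (1 - r ^ 2) / 2 := by positivity
  refine tailBoundH_of_window' h le_rfl (fun i δ => prod_H_le' h ht i δ) (hT0.trans hT) fun m => le_trans ?_ hT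
  -- split the window sum into the polynomial and the geometric part
  have hsplit : ∑ i ∈ Ico N m, u 2 i * (1 / (8 * a₁ * (2 * (i : ℝ) + 1)) + (1 - 4 * a₁) ^ (2 * i) / 2) =
      (1 / 2) * ∑ i ∈ Ico N m, u 2 i / ((2 * (i : ℝ) + 1) * (4 * a₁)) +
        (1 / 2) * ∑ i ∈ Ico N m, u 2 i * r ^ (2 * i) := by
    rw [mul_sum, mul_sum, ← sum_add_distrib]
    refine sum_congr rfl fun i _ => ?_
    rw [hr]
    field_simp
    ring
  rw [hsplit]
  have h1 := window_two ha1 N m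
  have h2 := window_geo hr0 hr1 N m
  have e : u 2 N * (2 * (N : ℝ) + 2) / ((2 * (N : ℝ) + 1) * (8 * a₁)) =
      (1 / 2) * (u 2 N * (2 * (N : ℝ) + 2) / ((2 * (N : ℝ) + 1) * (4 * a₁))) := by
    field_simp
    ring
  rw [e]
  linarith

/-- **The sharper two-axes tail from a kernel check** (cleared form; `r = (DA - 4A₁)/DA`):
`u 2 N · [(2N+2) DA² (DA² - (DA-4A₁)²) + 4A₁ (2N+1) (DA-4A₁)^{2N} DA^{2-2N}…]` — stated directly over `ℚ`. -/
theorem tailBoundH_of_twoQ' (ht : 2 ≤ t) {A0 A1 A2 DA : ℕ} (hDA : A0 + 2 * A1 + 2 * A2 = DA) (hA1 : 0 < A1)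
    (hA4 : 4 * A1 + 2 * A2 ≤ DA) (hA4' : 4 * A1 < DA) (N : ℕ) {Tn DG : ℕ}
    (h : uqv (OSM.vrow 2 N) 2 N * (2 * (N : ℚ) + 2) / ((2 * (N : ℚ) + 1) * (8 * ((A1 : ℚ) / DA))) +
      uqv (OSM.vrow 2 N) 2 N * (1 - 4 * ((A1 : ℚ) / DA)) ^ (2 * N) / (1 - (1 - 4 * ((A1 : ℚ) / DA)) ^ 2) / 2 ≤
        (Tn : ℚ) / DG) :
    TailBoundH t 2 ((A1 : ℝ) / DA) ((A2 : ℝ) / DA) N ((Tn : ℝ) / DG) := by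
  have hadm := adm_of_nat hDA hA1 hA4
  have hDAR : (0 : ℝ) < DA := by exact_mod_cast (by omega : 0 < DA)
  have ha : 4 * ((A1 : ℝ) / DA) < 1 := by
    rw [show 4 * ((A1 : ℝ) / DA) = (4 * A1 : ℝ) / DA by ring, div_lt_one hDAR]; exact_mod_cast hA4'
  refine tailBound_two' hadm ht ha N ?_
  have h' := (Rat.cast_le (K := ℝ)).2 h
  push_cast at h'
  rw [uqv_cast le_rfl] at h'
  exact h'

end Summit.CriticalPhenomena.PercolationContinuityZ3.Theorems.Pcint.BSMX

end
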